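import Literature.NumberTheory.GelbartRogawski1991.OscillatorTripleDictionary
import HarnessLib

/-!
# The `U(3)` oscillator-triple dictionary — the EXISTENCE half of (a) and the OCCURRENCE direction of (c), as separate records
# (edition E-III2 / R1′ of the cell hodgecm-mathlib, director g4 RULING s49, 2026-08-28)

Sibling of `OscillatorTripleDictionary.lean` (which it imports and leaves untouched): the two records of [Liu2021, proof of
Prop. 4.13, l. 2145] / [GR91, Thm 5.1.1 + Introduction p. 448] that the `h413` cone of the cell ACTUALLY READS, typed on their
own so that the floor theorem `hc_cm_of_floor_v10` can take them as binders in place of `oscillatorTriple_dictionary` /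
`muAdmissible_iff_multiplicity_one`, whose OTHER halves (label uniqueness over all `t : P.Triple`; the (⇒) direction «occurs ⇒
admissible» over all `t : P.Triple`) are over-quantified beyond print (REF1 audit 2026-08-28T12:49:36Z: a non-global `ε` is read
on the junk line `1` of the cell's Weil carriers; see the edition note below).  Definitions only (statement lane); NO PROOF of either record; no instance, no notation.

* `oscillatorTriple_dictionaryExistence P` — (a), existence half, index `AdmTriple` (junk-free);
* `admissible_occursInH1 P` — (c), (⇐) at admissible weight-one triples (junk-free: admissible ⇒ `ε` global);
* the kernel bridges «landed record ⇒ cut» (`dictionaryExistence_of_dictionary`, `admissible_occursInH1_of_iff`,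
  `admissible_occursInH1_of_multOne` — the edition is a WEAKENING) live with the consumers in
  `Summits/HodgeConjecture/HodgeConjecture/Theorems/A3Liu413DictionaryStubsByName.lean` (proof lane), keeping this file
  definitions-only.

References: as in `OscillatorTripleDictionary.lean` — [Liu2021] proof of Prop. 4.13 (FJcycle.tex l. 2131–2146, esp. l. 2145),
Rem. 4.14 (l. 2148), Def. 4.11 (l. 2088: the proviso «`ε_v ∈ 𝔬^×·Nm` for all but finitely many `v`»), Def. 4.12;
[GelbartRogawski1991] Introduction pp. 446–448, Thm 5.1.1 p. 465; [Li1992] Thm 2.1 (Rallis inner product formula).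
-/

noncomputable section

open NumberField

namespace Literature.NumberTheory.GelbartRogawski1991

open Literature.NumberTheory.Automorphic Literature.NumberTheory.Automorphic.Liu2021
open OscillatorTripleDictionary

variable {F E : Type} [Field F] [NumberField F] [IsTotallyReal F] [Field E] [NumberField E] [Algebra F E]
  [IsTotallyComplex E] [Algebra.IsQuadraticExtension F E]

/-! ## Edition E-III2 (R1′, director g4 RULING s49, 2026-08-28): the two records CUT to the sub-statements the `h413` cone reads

REF1's audit (2026-08-28T12:49:36Z): `oscillatorTriple_dictionary` (uniqueness conjunct) and `muAdmissible_iff_multiplicity_one`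
((⇒) direction) quantify over ALL `t : P.Triple`, whose `ε : Def411WeilCarriers.Eps` ranges over the FULL product of local sign
classes — print's proviso «`ε_v ∈ 𝔬^×·Nm` for all but finitely many `v`» ([Liu2021, Def. 4.11, l. 2088]) is not in the carrier,
and a non-global `ε` is read on the junk line `1`; on such triples the two records are false on paper.  The `h413` cone reads
ONLY the existence conjunct of (a) (index `AdmTriple`) and the (⇐) direction of (c) at ADMISSIBLE weight-one triples (where `ε`
is global, `Prop413AsPrinted.epsOf_global`), so the floor is re-keyed on exactly those two sub-statements, each IMPLIED by the
landed record (bridges below) — a WEAKENING toward print.  The landed records stay (append-only) for the readers of their other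
halves (`triple_unique`, `isAdmissible_of_occursInH1`, `rank_eq_one_iff_isAdmissible`). -/

/-- **B3-12 (a), EXISTENCE HALF ONLY** — for `U(3)` (`P.n = 3`): every irreducible representation `σ` of `𝔾(𝔸_F^∞)` occurring in
`H¹_{B,τ'}(A_∞, ℂ)` is `≅ ω_t` for SOME admissible weight-one triple `t : P.AdmTriple` ([Liu2021, proof of Prop. 4.13, l. 2145,
first sentence]: «if an irreducible admissible representation `π` of `G(𝔸)` contributes to the Albanese, then `π^∞ ≃ ω(μ,ε,χ)`
for a[n] adèlic oscillator triple in which `μ` is of weight one and `ε` is `μ`-admissible»; at `n = 3` = [GR91] Introduction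
p. 448 L30–33 with Thm 5.1.1 p. 465, read in Liu's labels per [Liu2021, Rem. 4.14]).  The index type `AdmTriple` carries
print's proviso (admissible ⇒ `ε` global), so no junk line is ever read.  = the first conjunct of `oscillatorTriple_dictionary`
(edition E-III2 / R1′: the uniqueness conjunct, unread by the `h413` cone, is dropped from the floor's binder).  TYPED as a
predicate on the consumer's `P`; NO PROOF.
[cite: Liu2021, proof of Prop. 4.13, l. 2145 (first sentence); Rem. 4.14 (l. 2148)]
[cite: GelbartRogawski1991, Introduction p. 448 L30–33; Thm 5.1.1 p. 465] -/
def oscillatorTriple_dictionaryExistence (P : Prop413Data F E) : Prop :=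
  P.n = 3 → ∀ (τ' : E →+* ℂ) (W : Type) [AddCommGroup W] [Module ℂ W] (σ : Representation ℂ P.G W),
    σ.IsIrreducible → OccursInH1 P τ' σ → ∃ t : P.AdmTriple, IsIsoToOmega P σ t.1

/-- **B3-12 (c), OCCURRENCE DIRECTION ONLY** — for `U(3)` (`P.n = 3`): for every triple `t = (μ, ε, χ)` with `μ` of weight one
and `ε` `μ`-ADMISSIBLE, `ω_t` OCCURS in `H¹_{B,τ'}(A_∞, ℂ)` ([Liu2021, proof of Prop. 4.13, l. 2145]: «Conversely, for every
such adèlic oscillator triple `(μ,ε,χ)`, there exists a pair `(W, π_W)` … `ω(μ,ε,χ)` is isomorphic to `π^∞` and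
`H¹(𝔤, K_G; π_∞) ≠ {0}` … `Θ^V_{(μ,ν),W}(π_W)` is contained in `L²_disc(G)`» — by the Rallis inner product formula [Li92, Thm 2.1]
and [Liu2021, Lem. D.2 (2)]).  Admissibility forces `ε` global (`Prop413AsPrinted.epsOf_global`), so no junk line is ever read.
= the (⇐) direction of `muAdmissible_iff_multiplicity_one` (edition E-III2 / R1′: the (⇒) direction, unread by the `h413`
cone and false on non-global `ε`, is dropped from the floor's binder).  TYPED as a predicate on the consumer's `P`; NO PROOF.
[cite: Liu2021, proof of Prop. 4.13, l. 2145 («Conversely …»); App. D Lem. D.2 (2)]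
[cite: Li1992, Thm. 2.1] [cite: GelbartRogawski1991, Introduction p. 446 L9–11; Thm 5.1.1 p. 465] -/
def admissible_occursInH1 (P : Prop413Data F E) : Prop :=
  P.n = 3 → ∀ (τ' : E →+* ℂ) (t : P.Triple), t.HasWeightOne → t.IsAdmissible → OccursInH1 P τ' (rhoTriple P t)


end Literature.NumberTheory.GelbartRogawski1991

end
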